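import Summits.BirchSwinnertonDyer.BirchSwinnertonDyer.Theorems.ByReductionTypeAtTwoTowerFiltrationGap
import Literature.NumberTheory.EllipticCurves.IwasawaDualModule
import HarnessLib

/-!
# The MODULE-FILTRATION certificate, part 4: the EXPONENT lever — `ν^{t}(A_n[p]) ⊆ Sel_{p^∞}(E/K_n)[p]` when every
# local block has order `≤ 2^t` (route ByReductionTypeAtTwo, crux `MultUpperHalfAtTwo`, item stmt-BirchSwinnertonDyer-19922;
# seat bsd-2adic-mult-2 GEN 11, part 1 of 2 of the kernel)

HONEST FRAMING (cell `bsd-2adic`, run/shared/lean/pub/bsd-2adic/, HUMAN RULINGS D-0036/D-0054/D-0074): THEOREMS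
ONLY; nothing asserted; no definition; no new named fact; closes nothing by itself; BSD is not proved by any
of this. PARTITION: X5@2 mult (K4ᵐ, B1·O1) × p = 2 — types-the-object-of (a sharper per-class certificate
format for item 19922 AT the class); closes none. bears_on: K4 (route-BirchSwinnertonDyer-ByReductionTypeAtTwo item 19922).

THE LEVER. Parts 1–3 (GEN 9) read T10's gap off ONE layer `K_n` through a WINDOW of the `ν = (conj_γ − id)`-filtration
of `Sel_{p^∞}(E/K_n)[p]`, charging the SUM `Σ_v (bits at v)·(#places of K_n over v)` of Greenberg's local error terms
(Lemma 3.5). Here the sum becomes a MAXIMUM. With `A_n = h_n⁻¹(Sel_∞) ≥ Sel_n` and, for a bad place `v`,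
`P_v ≤ A_n[p]` the classes satisfying the local condition at every place of `K_n` above `v`:
* §5 `iterate_mem_of_card_le` (algebra): a nilpotent endomorphism moves a finite group into a STABLE subgroup of index
  `≤ 2^D` in at most `D` steps (the chain `{x : ν^k x ∈ P}` at least doubles until it is everything);
* §6 `P_v` is `ν`-stable (the places above `v` are permuted by `γ`: `ργ = δρ'τ`, tree `conjH1_mul`, `conjH1_of_mem`,
  `localResOver_conjH1_resGal`) of index `≤ C_v^{#R_v}` (Greenberg's evaluation map at `v`), and `ν` is nilpotent on
  `A_n[p]` (`ν^{pⁿ} = 0` on `p`-torsion since `conj_{γ^{pⁿ}} = id`, tree `IwasawaDual.pow_mul_prime_pow_apply_eq_zero`);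
  hence **`iterate_conjSubId_mem_selmerLayer_of_localKernelBounds`: `ν^{t}(A_n[p]) ⊆ ⋂_v P_v = Sel_n[p]` as soon as
  `C_v^{#R_v} ≤ 2^t` for every `v ∈ S`** (any number field, any `ℤ_p`-extension, any `γ`, any layer).
Part 5 (`…TowerFiltrationExponentGap`) turns this into `O1.TowerGapAtTwo W` from `e + t < 2ⁿ`, `e` the exponent of `ν`
on `Sel_n[2]`: only the LARGEST local block is charged, not their sum.

References: R. Greenberg, LNM 1716 (1999), §1 p. 60, §3 pp. 85–90 (Lemmas 3.1–3.5); L. Washington, *Introduction to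
Cyclotomic Fields*, §13.2; J.-P. Serre, *Galois Cohomology*, I.§2.5.
-/
set_option autoImplicit false
-- the Theorems namespace of this sub repeats the summit name by design (D-0017 nested layout: Summit.<S>.<Sub>)
set_option linter.dupNamespace false

noncomputable section

open scoped Classical

open NumberField IsDedekindDomain WeierstrassCurve Literature.NumberTheory.EllipticCurves
  Literature.NumberTheory.EllipticCurves.IwasawaDual PowerSeries Summit.BirchSwinnertonDyer.Rank1Residual
  Summit.BirchSwinnertonDyer.Rank1Residual.X5.TowerGap Summit.BirchSwinnertonDyer.Rank1Residual.X5.O1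

universe u

namespace Summit.BirchSwinnertonDyer.BirchSwinnertonDyer.Theorems.TowerFiltration

/-! ## §5 Algebra: a nilpotent endomorphism reaches a stable subgroup of index `≤ 2^D` in `D` steps -/

section Algebra

variable {M : Type*} [AddCommGroup M]

/-- **Nilpotent descent into a stable subgroup.** `ν` an endomorphism of an abelian group, `P ≤ G` `ν`-stable subgroups, `G`
finite, `ν^N(G) ⊆ P` for some `N`, `#G ≤ 2^D · #P` ⟹ `ν^D(G) ⊆ P`: the chain `Q_k = {x ∈ G : ν^k x ∈ P}` rises from `P` to
`G`, is stationary once two consecutive terms agree, so it at least doubles (Lagrange) at each of `≤ log₂ [G:P] ≤ D` steps. [folklore] -/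
theorem iterate_mem_of_card_le (ν : M →+ M) {P G : AddSubgroup M} (hPG : P ≤ G)
    (hG : ∀ x ∈ G, ν x ∈ G) (hP : ∀ x ∈ P, ν x ∈ P) (hGfin : Finite G) {N : ℕ}
    (hnil : ∀ x ∈ G, (⇑ν)^[N] x ∈ P) {D : ℕ} (hcard : Nat.card G ≤ 2 ^ D * Nat.card P) :
    ∀ x ∈ G, (⇑ν)^[D] x ∈ P := by
  let Q : ℕ → AddSubgroup M := fun k ↦
    { carrier := {x | x ∈ G ∧ (⇑ν)^[k] x ∈ P}
      zero_mem' := ⟨zero_mem _, by rw [iterate_map_zero]; exact zero_mem _⟩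
      add_mem' := fun {a b} ha hb ↦ ⟨add_mem ha.1 hb.1, by rw [iterate_map_add]; exact add_mem ha.2 hb.2⟩
      neg_mem' := fun {a} ha ↦ ⟨neg_mem ha.1, by rw [iterate_map_neg]; exact neg_mem ha.2⟩ }
  have hQ : ∀ k x, x ∈ Q k ↔ x ∈ G ∧ (⇑ν)^[k] x ∈ P := fun _ _ ↦ Iff.rfl
  have hQG : ∀ k, Q k ≤ G := fun k x hx ↦ ((hQ k x).mp hx).1
  have hQ0 : Q 0 = P := by
    ext x
    rw [hQ, Function.iterate_zero, id]
    exact ⟨fun h ↦ h.2, fun h ↦ ⟨hPG h, h⟩⟩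
  have hQN : Q N = G := le_antisymm (hQG N) fun x hx ↦ (hQ N x).mpr ⟨hx, hnil x hx⟩
  have hmono : ∀ k, Q k ≤ Q (k + 1) := fun k x hx ↦ by
    rw [hQ] at hx ⊢
    refine ⟨hx.1, ?_⟩
    rw [Function.iterate_succ_apply']
    exact hP _ hx.2
  have hmono' : ∀ k j, Q k ≤ Q (k + j) := fun k j ↦ by
    induction j with
    | zero => exact le_rfl
    | succ j ih => exact ih.trans (hmono (k + j))
  -- `Q (k+2) = {x ∈ G : ν x ∈ Q (k+1)}`
  have hstep : ∀ k x, x ∈ G → (x ∈ Q (k + 1) ↔ ν x ∈ Q k) := fun k x hx ↦ by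
    rw [hQ, hQ, Function.iterate_succ_apply]
    exact ⟨fun h ↦ ⟨hG x hx, h.2⟩, fun h ↦ ⟨hx, h.2⟩⟩
  have hstat : ∀ k, Q k = Q (k + 1) → ∀ j, Q (k + j) = Q k := by
    intro k hk j
    induction j with
    | zero => rfl
    | succ j ih =>
      cases j with
      | zero => exact hk.symm
      | succ j =>
        have hprev : Q (k + j + 1) = Q (k + j) := by
          have := ih
          rw [show k + (j + 1) = k + j + 1 from by ring] at this
          rw [this]
          have h2 := hmono' k j
          have h3 : Q (k + j) ≤ Q (k + j + 1) := hmono (k + j)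
          exact le_antisymm h2 (by rw [← this]; exact h3) |>.symm ▸ rfl
        ext x
        rw [show k + (j + 1 + 1) = (k + j + 1) + 1 from by ring]
        constructor
        · intro hx
          have hxG := hQG _ hx
          rw [hstep _ x hxG, hprev, ← hstep _ x hxG] at hx
          rw [← ih, show k + (j + 1) = k + j + 1 from by ring]
          exact hx
        · intro hx
          exact hmono' k (j + 1 + 1) (by simpa using hx)
  haveI hQfin : ∀ k, Finite (Q k) := fun k ↦
    Finite.of_injective (fun x : Q k ↦ (⟨x.1, hQG k x.2⟩ : G))
      fun x y h ↦ Subtype.ext (by simpa using congrArg (fun z : G ↦ (z : M)) h)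
  haveI : Finite P := Finite.of_injective (fun x : P ↦ (⟨x.1, hPG x.2⟩ : G))
    fun x y h ↦ Subtype.ext (by simpa using congrArg (fun z : G ↦ (z : M)) h)
  have hPpos : 0 < Nat.card P := Nat.card_pos
  have hmain : ∀ k, Q k = G ∨ 2 ^ k * Nat.card P ≤ Nat.card (Q k) := by
    intro k
    induction k with
    | zero => exact Or.inr (by rw [pow_zero, one_mul, hQ0])
    | succ k ih =>
      rcases ih with h | h
      · exact Or.inl (le_antisymm (hQG _) (h ▸ hmono k))
      · by_cases hkG : Q k = G
        · exact Or.inl (le_antisymm (hQG _) (hkG ▸ hmono k))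
        · right
          -- `Q k < Q (k+1)` strictly
          have hne : Q k ≠ Q (k + 1) := by
            intro heq
            apply hkG
            have h1 : Q (k + N) = Q k := hstat k heq N
            have h2 : G ≤ Q (k + N) := by rw [← hQN, show k + N = N + k from add_comm _ _]; exact hmono' N k
            exact le_antisymm (hQG k) (h1 ▸ h2)
          have hdvd : Nat.card (Q k) ∣ Nat.card (Q (k + 1)) := AddSubgroup.card_dvd_of_le (hmono k)
          have hne' : Nat.card (Q k) ≠ Nat.card (Q (k + 1)) := fun hc ↦
            hne (AddSubgroup.eq_of_le_of_card_ge (hmono k) hc.ge)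
          obtain ⟨c, hc⟩ := hdvd
          have hc2 : 2 ≤ c := by
            rcases Nat.lt_or_ge c 2 with hlt | hge
            · interval_cases c
              · rw [mul_zero] at hc
                exact absurd hc (Nat.pos_iff_ne_zero.mp (Nat.card_pos (α := Q (k + 1))))
              · rw [mul_one] at hc; exact absurd hc.symm hne'
            · exact hge
          calc 2 ^ (k + 1) * Nat.card P = 2 * (2 ^ k * Nat.card P) := by ring
            _ ≤ 2 * Nat.card (Q k) := Nat.mul_le_mul_left _ h
            _ ≤ c * Nat.card (Q k) := Nat.mul_le_mul_right _ hc2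
            _ = Nat.card (Q (k + 1)) := by rw [hc, mul_comm]
  have hQD : Q D = G := by
    rcases hmain D with h | h
    · exact h
    · by_contra hne
      have hdvd : Nat.card (Q D) ∣ Nat.card G := AddSubgroup.card_dvd_of_le (hQG D)
      have hne' : Nat.card (Q D) ≠ Nat.card G := fun hc ↦
        hne (AddSubgroup.eq_of_le_of_card_ge (hQG D) hc.ge)
      obtain ⟨c, hc⟩ := hdvd
      have hc2 : 2 ≤ c := by
        rcases Nat.lt_or_ge c 2 with hlt | hge
        · interval_cases c
          · rw [mul_zero] at hc
            exact absurd hc (Nat.pos_iff_ne_zero.mp (Nat.card_pos (α := G)))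
          · rw [mul_one] at hc; exact absurd hc.symm hne'
        · exact hge
      have : 2 * Nat.card (Q D) ≤ Nat.card (Q D) :=
        calc 2 * Nat.card (Q D) ≤ c * Nat.card (Q D) := Nat.mul_le_mul_right _ hc2
          _ = Nat.card G := by rw [hc, mul_comm]
          _ ≤ 2 ^ D * Nat.card P := hcard
          _ ≤ Nat.card (Q D) := h
      have hpos : 0 < Nat.card (Q D) := Nat.card_pos
      omega
  intro x hx
  have : x ∈ Q D := by rw [hQD]; exact hx
  exact ((hQ D x).mp this).2

end Algebra

/-! ## §6 The layer: `ν^{t}(A_n[p]) ⊆ Sel_n[p]` when every local block has order `≤ 2^t` -/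

section Layer

variable {K : Type u} [Field K] [NumberField K] (W : WeierstrassCurve K) [W.IsElliptic] {p : ℕ}
  [hp : Fact p.Prime] (κ : ZpExtension K p) {γ : Field.absoluteGaloisGroup K}

omit [W.IsElliptic] in
/-- **`A_n = h_n⁻¹(Sel_∞)` is stable under `conj_γ`** (`h_n ∘ conj_γ = conj_γ ∘ h_n`, tree `layerToInfty_conjH1`,
and `Sel_∞` is `conj_γ`-stable, tree `map_conjH1_selmerGroupOver_le`). [cite: GreenbergLNM1716, §1 (after Conj. 1.3) and §3 p. 86] -/
theorem conjH1_mem_selmerInftyPreimage (γ : Field.absoluteGaloisGroup K) {n : ℕ}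
    {y : W.subgroupH1 p (κ.layerSubgroup n)} (hy : y ∈ W.selmerInftyPreimage κ n) :
    W.conjH1 p (κ.layerSubgroup n) γ y ∈ W.selmerInftyPreimage κ n := by
  rw [mem_selmerInftyPreimage_iff] at hy ⊢
  rw [W.layerToInfty_conjH1 κ γ y]
  exact W.map_conjH1_selmerGroupOver_le_holds p κ.kerSubgroup γ ⟨_, hy, rfl⟩

omit [NumberField K] [W.IsElliptic] hp in
/-- `(conj_σ)^m = conj_{σ^m}` in the endomorphism ring of `H¹(H, E[p^∞])` (`conjH1_one`, `conjH1_mul`). [cite: SerreGaloisCohomology1997, I.§2.5] -/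
theorem conjH1_pow_eq (H : Subgroup (Field.absoluteGaloisGroup K)) [H.Normal] (σ : Field.absoluteGaloisGroup K)
    (φ : AddMonoid.End (W.subgroupH1 p H)) (hφ : φ = W.conjH1 p H σ) (m : ℕ) : φ ^ m = W.conjH1 p H (σ ^ m) := by
  subst hφ
  induction m with
  | zero => rw [pow_zero, pow_zero]; exact (W.conjH1_one_holds p H).symm
  | succ m ih => rw [pow_succ, pow_succ, W.conjH1_mul_holds p H, ih]; rfl

omit [NumberField K] [W.IsElliptic] hp in
/-- The `End`-power `(conj_γ − 1)^k` is the `k`-th iterate of `conj_γ − id` on `H¹(H, E[p^∞])`. [folklore] -/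
theorem conjH1_sub_one_pow_apply (H : Subgroup (Field.absoluteGaloisGroup K)) [H.Normal]
    (σ : Field.absoluteGaloisGroup K) (φ : AddMonoid.End (W.subgroupH1 p H)) (hφ : φ = W.conjH1 p H σ)
    (k : ℕ) (y : W.subgroupH1 p H) :
    ((φ - 1) ^ k) y = (⇑(W.conjH1 p H σ - AddMonoidHom.id (W.subgroupH1 p H)))^[k] y := by
  subst hφ
  induction k generalizing y with
  | zero => rw [pow_zero, AddMonoid.End.one_apply, Function.iterate_zero, id]
  | succ k ih =>
    rw [pow_succ, AddMonoid.End.coe_mul, Function.comp_apply, ih, Function.iterate_succ_apply]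
    rfl

omit [NumberField K] [W.IsElliptic] in
/-- **`conj_γ − id` is nilpotent on the `p`-torsion of `H¹(K_n, E[p^∞])`: `(conj_γ − id)^{pⁿ} y = 0` when `p·y = 0`.**
`γ^{pⁿ} ∈ Gal(K̄/K_n)` acts trivially (`conjH1_of_mem`), and `(φ − 1)^{pⁿ} y = 0` for `φ^{pⁿ} y = y`, `p y = 0`
(tree `IwasawaDual.pow_mul_prime_pow_apply_eq_zero`: `(1+ν)^{pⁿ} ≡ 1 + ν^{pⁿ} (mod p)`).
[cite: Washington1997, §13.2 (Lemma 13.15 ff.)] -/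
theorem iterate_conjSubId_apply_eq_zero_of_smul_eq_zero (γ : Field.absoluteGaloisGroup K) (n : ℕ)
    (y : W.subgroupH1 p (κ.layerSubgroup n)) (hy : p • y = 0) :
    (⇑(W.conjH1 p (κ.layerSubgroup n) γ - AddMonoidHom.id (W.subgroupH1 p (κ.layerSubgroup n))))^[p ^ n] y = 0 := by
  let φ : AddMonoid.End (W.subgroupH1 p (κ.layerSubgroup n)) := W.conjH1 p (κ.layerSubgroup n) γ
  have hφ : φ = W.conjH1 p (κ.layerSubgroup n) γ := rfl
  have hfix : (φ ^ p ^ n) y = y := by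
    rw [conjH1_pow_eq W _ γ φ hφ, W.conjH1_of_mem_holds p (κ.layerSubgroup n)
      (X1.GeneratorCountLayer.pow_mem_layerSubgroup κ γ n)]
    rfl
  have h := IwasawaDual.pow_mul_prime_pow_apply_eq_zero hp.out φ n (k := 1) hfix (by rwa [pow_one])
  rw [one_mul, conjH1_sub_one_pow_apply W _ γ φ hφ] at h
  exact h

omit [W.IsElliptic] in
/-- **`ν^{t}(A_n[p]) ⊆ Sel_{p^∞}(E/K_n)[p]` when every local block has order `≤ 2^t`** (`ν = conj_γ − id`). Setting:
ANY number field `K`, ANY `ℤ_p`-extension `κ`, any `γ ∈ Γ_K`, any layer `n`; a finite set `S` of finite places with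
`𝒦_{v,n}[p^∞] = 0` off `S` (`h0`), `#𝒦_{v,n}[p] ≤ C_v` on `S` (`hC`), finite covering sets `R_v`
(`Γ_K = ⋃_{ρ ∈ R_v} D_v ρ Gal(K̄/K_n)`, `hR`), `A_n[p]` finite, and **`C_v^{#R_v} ≤ 2^t` for every `v ∈ S`**. For
`v ∈ S` the classes of `A_n[p]` satisfying the local condition at every place above `v`,
`P_v = {z : loc_v(conj_ρ z) = 0 ∀ ρ ∈ R_v}`, form a `ν`-STABLE subgroup (`ργ = δρ'τ`: `conjH1_mul`, `conjH1_of_mem`,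
`localResOver_conjH1_resGal`) of index `≤ C_v^{#R_v}` (the evaluation map of Lemma 3.5 at `v`); `ν` is nilpotent
on `A_n[p]`; so `ν^{t}(A_n[p]) ⊆ P_v` (§5), for every `v`, and `⋂_v P_v ⊆ Sel_n`
(tree `mem_selmerLayer_of_forall_localResOver_conjH1_eq_zero`). [cite: GreenbergLNM1716, §3 Lemma 3.5 (proof, p. 90)] -/
theorem iterate_conjSubId_mem_selmerLayer_of_localKernelBounds {n t : ℕ}
    (S : Finset (HeightOneSpectrum (𝓞 K))) (C : HeightOneSpectrum (𝓞 K) → ℕ)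
    (R : HeightOneSpectrum (𝓞 K) → Finset (Field.absoluteGaloisGroup K))
    (h0 : ∀ v ∉ S, W.localTowerKerPrimary κ (v.adicCompletion K) n = ⊥)
    (hC : ∀ v ∈ S, Finite {x : W.localTowerKerPrimary κ (v.adicCompletion K) n // p • x = 0} ∧
      Nat.card {x : W.localTowerKerPrimary κ (v.adicCompletion K) n // p • x = 0} ≤ C v)
    (hR : ∀ v ∈ S, ∀ σ : Field.absoluteGaloisGroup K, ∃ ρ ∈ R v,
      ∃ δ : Field.absoluteGaloisGroup (v.adicCompletion K), ∃ τ ∈ κ.layerSubgroup n,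
        σ = resGal (K := K) (v.adicCompletion K) δ * ρ * τ)
    (hexp : ∀ v ∈ S, C v ^ (R v).card ≤ 2 ^ t)
    (hfin : Finite {z : W.selmerInftyPreimage κ n // p • z = 0})
    {y : W.subgroupH1 p (κ.layerSubgroup n)} (hy : y ∈ W.selmerInftyPreimage κ n) (hpy : p • y = 0) :
    (⇑(W.conjH1 p (κ.layerSubgroup n) γ - AddMonoidHom.id (W.subgroupH1 p (κ.layerSubgroup n))))^[t] y ∈
        W.selmerLayer κ n ∧
      p • (⇑(W.conjH1 p (κ.layerSubgroup n) γ - AddMonoidHom.id (W.subgroupH1 p (κ.layerSubgroup n))))^[t] y = 0 := by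
  set ν : W.subgroupH1 p (κ.layerSubgroup n) →+ W.subgroupH1 p (κ.layerSubgroup n) :=
    W.conjH1 p (κ.layerSubgroup n) γ - AddMonoidHom.id (W.subgroupH1 p (κ.layerSubgroup n)) with hν
  have hνp : ∀ (k : ℕ) (x : W.subgroupH1 p (κ.layerSubgroup n)), p • (⇑ν)^[k] x = (⇑ν)^[k] (p • x) := fun k ↦ by
    induction k with
    | zero => intro x; rfl
    | succ k ih => intro x; rw [Function.iterate_succ_apply', Function.iterate_succ_apply', ← map_nsmul, ih]
  -- the group `G = A_n[p]`
  let G : AddSubgroup (W.subgroupH1 p (κ.layerSubgroup n)) :=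
    { carrier := {x | x ∈ W.selmerInftyPreimage κ n ∧ p • x = 0}
      zero_mem' := ⟨zero_mem _, smul_zero _⟩
      add_mem' := fun {a b} ha hb ↦ ⟨add_mem ha.1 hb.1, by rw [smul_add, ha.2, hb.2, add_zero]⟩
      neg_mem' := fun {a} ha ↦ ⟨neg_mem ha.1, by rw [smul_neg, ha.2, neg_zero]⟩ }
  have hGmem : ∀ x, x ∈ G ↔ x ∈ W.selmerInftyPreimage κ n ∧ p • x = 0 := fun _ ↦ Iff.rfl
  have hGν : ∀ x ∈ G, ν x ∈ G := fun x hx ↦ by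
    rw [hGmem] at hx ⊢
    refine ⟨?_, ?_⟩
    · rw [hν, AddMonoidHom.sub_apply, AddMonoidHom.id_apply]
      exact sub_mem (conjH1_mem_selmerInftyPreimage W κ γ hx.1) hx.1
    · have := hνp 1 x
      rw [Function.iterate_one] at this
      rw [this, hx.2, map_zero]
  have hGfin : Finite G :=
    Finite.of_injective (fun x : G ↦ (⟨⟨x.1, x.2.1⟩, by
        apply Subtype.ext
        change p • (x.1 : W.subgroupH1 p (κ.layerSubgroup n)) = 0
        exact x.2.2⟩ : {z : W.selmerInftyPreimage κ n // p • z = 0}))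
      fun x x' h ↦ by
        apply Subtype.ext
        have := congrArg (fun z : {z : W.selmerInftyPreimage κ n // p • z = 0} ↦
          ((z.1 : W.selmerInftyPreimage κ n) : W.subgroupH1 p (κ.layerSubgroup n))) h
        exact this
  have hnil : ∀ x ∈ G, (⇑ν)^[p ^ n] x = 0 := fun x hx ↦
    iterate_conjSubId_apply_eq_zero_of_smul_eq_zero W κ γ n x hx.2
  have hyG : y ∈ G := ⟨hy, hpy⟩
  have hiter : ∀ k, ∀ x ∈ G, (⇑ν)^[k] x ∈ G := fun k ↦ by
    induction k with
    | zero => intro x hx; exact hx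
    | succ k ih => intro x hx; rw [Function.iterate_succ_apply']; exact hGν _ (ih x hx)
  have hty : (⇑ν)^[t] y ∈ G := hiter t y hyG
  refine ⟨?_, hty.2⟩
  -- for each `v ∈ S`: the partial Selmer condition `P_v`
  have hloc : ∀ v ∈ S, ∀ ρ ∈ R v,
      W.localResOver p (κ.layerSubgroup n) (v.adicCompletion K)
        (W.conjH1 p (κ.layerSubgroup n) ρ ((⇑ν)^[t] y)) = 0 := by
    intro v hv
    let E := v.adicCompletion K
    let Pv : AddSubgroup (W.subgroupH1 p (κ.layerSubgroup n)) :=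
      { carrier := {x | x ∈ G ∧ ∀ ρ ∈ R v,
          W.localResOver p (κ.layerSubgroup n) E (W.conjH1 p (κ.layerSubgroup n) ρ x) = 0}
        zero_mem' := ⟨zero_mem _, fun ρ _ ↦ by rw [map_zero, map_zero]⟩
        add_mem' := fun {a b} ha hb ↦ ⟨add_mem ha.1 hb.1, fun ρ hρ ↦ by
          rw [map_add, map_add, ha.2 ρ hρ, hb.2 ρ hρ, add_zero]⟩
        neg_mem' := fun {a} ha ↦ ⟨neg_mem ha.1, fun ρ hρ ↦ by rw [map_neg, map_neg, ha.2 ρ hρ, neg_zero]⟩ }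
    have hPvmem : ∀ x, x ∈ Pv ↔ x ∈ G ∧ ∀ ρ ∈ R v,
        W.localResOver p (κ.layerSubgroup n) E (W.conjH1 p (κ.layerSubgroup n) ρ x) = 0 := fun _ ↦ Iff.rfl
    have hPvG : Pv ≤ G := fun x hx ↦ hx.1
    -- `P_v` is `conj_γ`-stable, hence `ν`-stable
    have hPvconj : ∀ x ∈ Pv, W.conjH1 p (κ.layerSubgroup n) γ x ∈ Pv := by
      intro x hx
      rw [hPvmem] at hx ⊢
      refine ⟨⟨conjH1_mem_selmerInftyPreimage W κ γ hx.1.1, by rw [← map_nsmul, hx.1.2, map_zero]⟩,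
        fun ρ hρ ↦ ?_⟩
      obtain ⟨ρ', hρ', δ, τ, hτ, hdec⟩ := hR v hv (ρ * γ)
      have hcomp : W.conjH1 p (κ.layerSubgroup n) ρ (W.conjH1 p (κ.layerSubgroup n) γ x) =
          W.conjH1 p (κ.layerSubgroup n) (ρ * γ) x := by
        rw [W.conjH1_mul_holds p (κ.layerSubgroup n) ρ γ]; rfl
      rw [hcomp, hdec,
        W.conjH1_mul_holds p (κ.layerSubgroup n) (resGal (K := K) E δ * ρ') τ,
        AddMonoidHom.comp_apply, W.conjH1_of_mem_holds p (κ.layerSubgroup n) hτ, AddMonoidHom.id_apply,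
        W.conjH1_mul_holds p (κ.layerSubgroup n) (resGal (K := K) E δ) ρ', AddMonoidHom.comp_apply,
        localResOver_conjH1_resGal, hx.2 ρ' hρ', map_zero]
    have hPvν : ∀ x ∈ Pv, ν x ∈ Pv := fun x hx ↦ by
      rw [hν, AddMonoidHom.sub_apply, AddMonoidHom.id_apply]
      exact sub_mem (hPvconj x hx) hx
    -- the index bound `#G ≤ 2^t · #P_v` (evaluation map at the places above `v`)
    have hcard : Nat.card G ≤ 2 ^ t * Nat.card Pv := by
      haveI := hGfin
      haveI : Finite Pv := Finite.of_injective (fun x : Pv ↦ (⟨x.1, hPvG x.2⟩ : G))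
        fun x x' h ↦ Subtype.ext (by simpa using congrArg (fun z : G ↦ (z : W.subgroupH1 p (κ.layerSubgroup n))) h)
      haveI hfinK : Finite {x : W.localTowerKerPrimary κ E n // p • x = 0} := (hC v hv).1
      let Φ : G →+ ((ρ : ↥(R v)) → discreteH1 (localSubgroup (κ.layerSubgroup n) E) (localPoints W E)) :=
        AddMonoidHom.pi fun ρ ↦
          ((W.localResOver p (κ.layerSubgroup n) E).comp (W.conjH1 p (κ.layerSubgroup n) (ρ : Field.absoluteGaloisGroup K))).comp
            G.subtype
      have hΦ : ∀ (x : G) (ρ : ↥(R v)),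
          Φ x ρ = W.localResOver p (κ.layerSubgroup n) E
            (W.conjH1 p (κ.layerSubgroup n) ρ (x : W.subgroupH1 p (κ.layerSubgroup n))) := fun _ _ ↦ rfl
      -- values: `p`-torsion classes of `𝒦_{v,n}[p^∞]`
      have hval : ∀ (x : G) (ρ : ↥(R v)), Φ x ρ ∈ W.localTowerKerPrimary κ E n ∧ p • Φ x ρ = 0 := by
        intro x ρ
        have hpx : p • Φ x ρ = 0 := by
          rw [hΦ, ← map_nsmul, ← map_nsmul]
          have : p • (x : W.subgroupH1 p (κ.layerSubgroup n)) = 0 := x.2.2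
          rw [this, map_zero, map_zero]
        exact ⟨⟨by rw [hΦ]; exact W.localResOver_conjH1_mem_localTowerKer_of_mem κ x.2.1 _ _, 1,
          by rw [pow_one]; exact hpx⟩, hpx⟩
      let g : Φ.range → ((ρ : ↥(R v)) → {x : W.localTowerKerPrimary κ E n // p • x = 0}) := fun z ρ ↦
        ⟨⟨z.1 ρ, by obtain ⟨x, hx⟩ := z.2; rw [← hx]; exact (hval x ρ).1⟩,
          TowerLayer.nsmul_mk_eq_zero _ _ (by obtain ⟨x, hx⟩ := z.2; rw [← hx]; exact (hval x ρ).2)⟩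
      have hg : Function.Injective g := by
        intro z z' h
        refine Subtype.ext (funext fun ρ ↦ ?_)
        have := congrArg (fun w : ((ρ : ↥(R v)) → {x : W.localTowerKerPrimary κ E n // p • x = 0}) ↦
          (((w ρ).1 : W.localTowerKerPrimary κ E n) : discreteH1 (localSubgroup (κ.layerSubgroup n) E) (localPoints W E))) h
        exact this
      haveI : Finite Φ.range := Finite.of_injective g hg
      have hrange : Nat.card Φ.range ≤ 2 ^ t :=
        calc Nat.card Φ.range
            ≤ Nat.card ((ρ : ↥(R v)) → {x : W.localTowerKerPrimary κ E n // p • x = 0}) :=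
              Nat.card_le_card_of_injective g hg
          _ = ∏ ρ : ↥(R v), Nat.card {x : W.localTowerKerPrimary κ E n // p • x = 0} := Nat.card_pi
          _ ≤ ∏ ρ : ↥(R v), C v := Finset.prod_le_prod (fun _ _ ↦ Nat.zero_le _) fun _ _ ↦ (hC v hv).2
          _ = C v ^ (R v).card := by rw [Finset.prod_const, Finset.card_univ, Fintype.card_coe]
          _ ≤ 2 ^ t := hexp v hv
      -- kernel: inside `P_v`
      let kerToPv : Φ.ker → Pv := fun z ↦ ⟨(z.1 : W.subgroupH1 p (κ.layerSubgroup n)), z.1.2, fun ρ hρ ↦ by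
        have := congrFun (show Φ z.1 = 0 from z.2) ⟨ρ, hρ⟩
        rw [hΦ] at this
        exact this⟩
      have hker : Function.Injective kerToPv := by
        intro z z' h
        have := congrArg (fun w : Pv ↦ (w : W.subgroupH1 p (κ.layerSubgroup n))) h
        exact Subtype.ext (Subtype.ext this)
      have hkerle : Nat.card Φ.ker ≤ Nat.card Pv := Nat.card_le_card_of_injective kerToPv hker
      have hGeq : Nat.card G = Nat.card Φ.ker * Nat.card Φ.range := by
        rw [← AddSubgroup.index_ker, AddSubgroup.card_mul_index]
      rw [hGeq, mul_comm]
      exact Nat.mul_le_mul hrange hkerle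
    -- §5
    have hmem : (⇑ν)^[t] y ∈ Pv :=
      iterate_mem_of_card_le ν hPvG hGν hPvν hGfin (N := p ^ n)
        (fun x hx ↦ by rw [hnil x hx]; exact zero_mem _) hcard y hyG
    exact hmem.2
  exact W.mem_selmerLayer_of_forall_localResOver_conjH1_eq_zero κ S h0 R hR hty.1 hloc

end Layer

end Summit.BirchSwinnertonDyer.BirchSwinnertonDyer.Theorems.TowerFiltration

end
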